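import Summits.CriticalPhenomena.Ising3D.IsingColumnFaceL11CensusSegmentAlgRoot

/-!
# The `ALG` census of §7.3 on the certified `Δε` segment as kernel facts, II: the enumerate-and-count
machine and its soundness (cell `pub-ising3x`, seat recog-1; paper §7.1 / §7.3)

HONEST FRAMING: lottery ticket; floor = tightest certified 3D Ising CFT bounds; no exact-solution
claim without a proof. Island framing: certified exclusion region at stated derivative order and
assumptions; not a determination of the 3D Ising critical exponents beyond that.

The machine behind the kernel theorems «17 867 / 24 584 / 20 260» (`…SegmentAlgA/B/C.lean`): for a table
rung `(d, H)` and a sub-window `[segCutQ k, segCutQ (k+1)]` it generates every coefficient list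
`c = c₀ :: (mid ++ [a_d])` with `a_d ∈ [1, H]`, `mid ∈ [−H, H]^{d−1}` and `c₀` in the SOLVED range of the
landed `ALG` checker (`leafRange` of `ExclusionSentencesAlgCore`: outside it `c` has no root in the window),
and attaches the exact number of roots of `c` in the window (`rootCount` of `…SegmentAlgRoot.lean`, depth
`40`; the two table polynomials with a double root in the segment, `(3X−4)²` and `(X³−X−1)²`, are counted
through their square roots, certified by exact multiplication) and the primitivity flag `gcd(c) = 1`:
* `coeffLoopL` (list twin of `coeffLoop`), `algTails`, `algC0lo` / `algC0hi`, `algCandsK d H k`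
  (`mem_algCandsK_iff`), `algRootCount` (`algRootCount_sound`), the description predicate `algDescrOK d H`
  (= `algPolyOK d H` ∧ positive leading coefficient ∧ content `1`: the recogniser's DESCRIPTIONS);
* COMPLETENESS `mem_algCandsK_of_root` (a description with a root in the window is a candidate: the
  `c₀`-range argument of `leafCheck_sound`); the kernel check `algSegCheck d H k N` (all candidates counted,
  codes `algCode` strictly increasing, the counts of the primitive candidates sum to `N`) and its MEANING
  `alg_descr_ncard_of_check`: the set of descriptions `(c, ξ)` of rung `(d, H)` with `ξ` in the closed
  sub-window `k` is finite with exactly `N` elements (`ncard_pairs_of_list`: a disjoint union over the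
  candidate polynomials of their finite root sets).
Pure arithmetic and real analysis over landed definitions; no certificate, no datum, no σ–ε axiom; nothing
is recognised (§1.6). Python twin (same enclosures, same bisection, cross-checked against Sturm sequences;
same counts): recog-1 gen 51 `twin_alg.py`.
lottery ticket; floor = tightest certified 3D Ising CFT bounds; no exact-solution claim without a proof.
-/

namespace Summit.CriticalPhenomena.Ising3D
namespace ColumnFaceL11
open Set Literature.MathematicalPhysics.QuantumFieldTheory.ConformalBootstrap3D

/-! ### Generators -/

/-- The tails `[a₁, …, a_d] = mid ++ [a_d]`: `mid ∈ [−H, H]^{d−1}` (outer, lexicographic), `a_d ∈ [1, H]`.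
[folklore] -/
def algTails (d : ℕ) (H : ℤ) : List (List ℤ) :=
  (coeffLoopL H (d - 1) []).flatMap fun mid => (iccList 1 H).map fun ad => mid ++ [ad]

/-- What `algTails` lists. [folklore] -/
theorem mem_algTails_iff {d : ℕ} {H : ℤ} {t : List ℤ} : t ∈ algTails d H ↔
    ∃ (mid : List ℤ) (ad : ℤ), mid.length = d - 1 ∧ (∀ y ∈ mid, -H ≤ y ∧ y ≤ H) ∧ (1 ≤ ad ∧ ad ≤ H) ∧
      t = mid ++ [ad] := by
  unfold algTails
  simp only [List.mem_flatMap, List.mem_map, mem_iccList]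
  constructor
  · rintro ⟨mid, hmid, ad, had, rfl⟩
    obtain ⟨pre, hlen, hb, hpre⟩ := (mem_coeffLoopL_iff _ _ _).mp hmid
    rw [List.nil_append] at hpre
    subst hpre
    exact ⟨_, ad, hlen, hb, had, rfl⟩
  · rintro ⟨mid, ad, hlen, hb, had, rfl⟩
    exact ⟨mid, (mem_coeffLoopL_iff _ _ _).mpr ⟨mid, hlen, hb, by simp⟩, ad, had, rfl⟩

/-- Enclosure of `x · (a₁ + a₂ x + ⋯)` on the window (the `leafRange` datum). [folklore] -/
def algTailEncl (a b : ℚ) (tail : List ℤ) : ℤ × ℤ × ℤ :=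
  encloseZ (qFrame a b).1 (qFrame a b).2.1 (qFrame a b).2.2 (0 :: tail)

/-- A SUPERSET of sub-window `k` with small denominators, used for the `c₀`-range and the first leaf
decision (a kernel-cost device: the scaled integers of the interval-Horner enclosure grow like
`(den a · den b)^{d+1}`, and `2855/2048` has denominator `2¹¹`): `[27/20, 7/5] ⊇ [27/20, 2855/2048]`; the
other sub-windows are their own superset. Root COUNTS always refer to the exact sub-window. [folklore] -/
def segSupQ (k : ℕ) : ℚ × ℚ :=
  match k with
  | 2 => (27 / 20, 7 / 5)
  | _ => (segCutQ k, segCutQ (k + 1))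

/-- `segSupQ k ⊇ [segCutQ k, segCutQ (k+1)]`, and its lower end is non-negative. [folklore] -/
theorem segSupQ_spec (k : ℕ) :
    (segSupQ k).1 ≤ segCutQ k ∧ segCutQ (k + 1) ≤ (segSupQ k).2 ∧ 0 ≤ (segSupQ k).1 := by
  have h0 : ∀ j, 0 ≤ segCutQ j := fun j => by unfold segCutQ; split <;> norm_num
  match k with
  | 0 => exact ⟨le_rfl, le_rfl, h0 0⟩
  | 1 => exact ⟨le_rfl, le_rfl, h0 1⟩
  | 2 => simp only [segSupQ, segCutQ]; norm_num
  | k + 3 => exact ⟨le_rfl, le_rfl, h0 _⟩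

/-- Lower end of the solved `c₀` range (as in `leafRange`). [folklore] -/
def algC0lo (H : ℤ) (a b : ℚ) (tail : List ℤ) : ℤ :=
  max (-H) (-((algTailEncl a b tail).2.1 / (algTailEncl a b tail).2.2))

/-- Upper end of the solved `c₀` range. [folklore] -/
def algC0hi (H : ℤ) (a b : ℚ) (tail : List ℤ) : ℤ :=
  min H ((-(algTailEncl a b tail).1) / (algTailEncl a b tail).2.2)

/-- Square roots of the two table polynomials with a double root in the segment: `9X²−24X+16 = (3X−4)²`,
`X⁶−2X⁴−2X³+X²+2X+1 = (X³−X−1)²` (coefficient lists, constant term first; the census counts DISTINCT roots,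
so such a description counts once). [folklore] -/
def algSqrt (c : List ℤ) : Option (List ℤ) :=
  if c == [16, -24, 9] then some [-4, 3] else if c == [1, 2, 1, -2, -2, 0, 1] then some [-1, -1, 0, 1] else none

/-- The roots of a LINEAR list `[c₀, c₁]`, `c₁ > 0`, in `[a, b]`: one (namely `−c₀/c₁`) iff
`c₁ a ≤ −c₀ ≤ c₁ b`, else none (closed form; the degree-1 rung has 23 215 candidates). [folklore] -/
theorem rootsIn_linear (c0 c1 : ℤ) (hc1 : 0 < c1) (a b : ℚ) :
    (rootsIn [c0, c1] a b).Finite ∧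
      (rootsIn [c0, c1] a b).ncard = if (c1 : ℚ) * a ≤ -c0 ∧ -(c0 : ℚ) ≤ c1 * b then 1 else 0 := by
  have hc1' : (0 : ℝ) < c1 := by exact_mod_cast hc1
  have hroot : ∀ x : ℝ, evalL [c0, c1] x = 0 ↔ x = -(c0 : ℝ) / c1 := by
    intro x
    simp only [evalL_cons, evalL_nil, mul_zero, add_zero]
    rw [eq_div_iff hc1'.ne']
    constructor <;> intro h <;> linarith
  by_cases hcond : (c1 : ℚ) * a ≤ -c0 ∧ -(c0 : ℚ) ≤ c1 * b
  · rw [if_pos hcond]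
    have hs : rootsIn [c0, c1] a b = {(-(c0 : ℝ) / c1)} := by
      ext x
      simp only [rootsIn, Set.mem_setOf_eq, Set.mem_singleton_iff, hroot]
      constructor
      · rintro ⟨-, -, h⟩; exact h
      · rintro rfl
        refine ⟨?_, ?_, rfl⟩
        · rw [le_div_iff₀ hc1']
          have : ((c1 : ℚ) : ℝ) * a ≤ -c0 := by exact_mod_cast hcond.1
          push_cast at this; linarith
        · rw [div_le_iff₀ hc1']
          have : -((c0 : ℚ) : ℝ) ≤ c1 * b := by exact_mod_cast hcond.2
          push_cast at this; linarith
    rw [hs]; exact ⟨Set.finite_singleton _, Set.ncard_singleton _⟩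
  · rw [if_neg hcond]
    have hs : rootsIn [c0, c1] a b = ∅ := by
      refine Set.eq_empty_iff_forall_notMem.mpr fun x hx => hcond ?_
      obtain ⟨h1, h2, h3⟩ := hx
      rw [hroot] at h3
      subst h3
      rw [le_div_iff₀ hc1'] at h1
      rw [div_le_iff₀ hc1'] at h2
      constructor
      · have : ((c1 : ℚ) : ℝ) * a ≤ -c0 := by push_cast; linarith
        exact_mod_cast this
      · have : -((c0 : ℚ) : ℝ) ≤ c1 * b := by push_cast; linarith
        exact_mod_cast this
    rw [hs]; exact ⟨Set.finite_empty, Set.ncard_empty _⟩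

/-- Root count on `[a, b]` (first leaf decision on the superset `[aS, bS]`): closed form for the linear
rung, the square short-cut (certified by exact multiplication) for the two double-root polynomials,
`rootCountS` (bisection depth `40`) otherwise. [folklore] -/
def algRootCount (c : List ℤ) (aS bS a b : ℚ) : Option ℕ :=
  match c with
  | [c0, c1] =>
    if 0 < c1 then some (if (c1 : ℚ) * a ≤ -c0 ∧ -(c0 : ℚ) ≤ c1 * b then 1 else 0)
    else rootCountS [c0, c1] aS bS a b
  | _ =>
    match algSqrt c with
    | some g => if polyMul g g == c then rootCountS g aS bS a b else none
    | none => rootCountS c aS bS a b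

/-- Soundness of `algRootCount`. [folklore] -/
theorem algRootCount_sound {c : List ℤ} {aS bS a b : ℚ} (haS : aS ≤ a) (hab : a ≤ b) (hbS : b ≤ bS) {m : ℕ}
    (h : algRootCount c aS bS a b = some m) : (rootsIn c a b).Finite ∧ (rootsIn c a b).ncard = m := by
  unfold algRootCount at h
  split at h
  · rename_i c0 c1
    by_cases hc1 : 0 < c1
    · rw [if_pos hc1] at h
      obtain rfl := Option.some.inj h
      exact rootsIn_linear c0 c1 hc1 a b
    · rw [if_neg hc1] at h
      exact rootCountS_sound haS hab hbS h
  · split at h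
    · rename_i g _
      split_ifs at h with hsq
      have hc : polyMul g g = c := eq_of_beq hsq
      rw [← hc, rootsIn_polyMul_self]
      exact rootCountS_sound haS hab hbS h
    · exact rootCountS_sound haS hab hbS h

/-- The count attached to a candidate: its root count if it is PRIMITIVE (content `1`), else `some 0` (a
non-primitive list is not a description and is not counted; this also keeps the non-primitive multiples of the
two double-root polynomials away from the root counter). [folklore] -/
def algCountOf (c : List ℤ) (k : ℕ) : Option ℕ :=
  if gcdList c = 1 then algRootCount c (segSupQ k).1 (segSupQ k).2 (segCutQ k) (segCutQ (k + 1)) else some 0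

/-- The candidates of rung `(d, H)` on sub-window `k`: `(count, content = 1 ?, c)`. [folklore] -/
def algCandsK (d H k : ℕ) : List (Option ℕ × Bool × List ℤ) :=
  (algTails d H).flatMap fun tail =>
    (iccList (algC0lo H (segSupQ k).1 (segSupQ k).2 tail) (algC0hi H (segSupQ k).1 (segSupQ k).2 tail)).map
      fun c0 => (algCountOf (c0 :: tail) k, gcdList (c0 :: tail) == 1, c0 :: tail)

/-- What `algCandsK` lists. [folklore] -/
theorem mem_algCandsK_iff {d H k : ℕ} {t : Option ℕ × Bool × List ℤ} : t ∈ algCandsK d H k ↔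
    ∃ tail ∈ algTails d H, ∃ c0 : ℤ, (algC0lo H (segSupQ k).1 (segSupQ k).2 tail ≤ c0 ∧
      c0 ≤ algC0hi H (segSupQ k).1 (segSupQ k).2 tail) ∧
      t = (algCountOf (c0 :: tail) k, gcdList (c0 :: tail) == 1, c0 :: tail) := by
  unfold algCandsK
  simp only [List.mem_flatMap, List.mem_map, mem_iccList]
  constructor
  · rintro ⟨tail, ht, c0, hc0, rfl⟩; exact ⟨tail, ht, c0, hc0, rfl⟩
  · rintro ⟨tail, ht, c0, hc0, rfl⟩; exact ⟨tail, ht, c0, hc0, rfl⟩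

/-- A mixed-radix code of a coefficient list, increasing along the generation order (used only to certify
that the candidate list has no duplicates). [folklore] -/
def algCode (H : ℕ) (c : List ℤ) : ℕ :=
  (c.drop 1 ++ c.take 1).foldl (fun acc y => acc * (2 * H + 1) + (y + (H : ℤ)).toNat) 0

/-- The kernel check of rung `(d, H)` on sub-window `k`: every candidate counted, codes strictly increasing,
and the root counts of the PRIMITIVE candidates sum to `N`. [folklore] -/
def algSegCheck (d H k N : ℕ) : Bool :=
  let L := algCandsK d H k
  (L.all fun t => t.1.isSome) && incrNat (L.map fun t => algCode H t.2.2) &&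
    (((L.filter fun t => t.2.1).map fun t => t.1.getD 0).sum == N)

/-! ### Descriptions and completeness -/

/-- The recogniser's DESCRIPTION polynomials of rung `(d, H)`: coefficient list of length `d + 1` with
entries in `[−H, H]` and non-zero top coefficient (`algPolyOK`), POSITIVE top coefficient, content `1`. [folklore] -/
def algDescrOK (d H : ℕ) (c : List ℤ) : Bool :=
  algPolyOK d H c && decide (0 < c.getD d 0) && (gcdList c == 1)

/-- **The `c₀`-range argument** (as in `leafCheck_sound`): a root `x ∈ [a, b]` of `c₀ :: tail` with
`c₀ ∈ [−H, H]` forces `c₀` into the solved range. [folklore] -/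
theorem alg_c0_mem_range {H : ℤ} {a b : ℚ} (ha : 0 ≤ a) {tail : List ℤ} {c0 : ℤ} (hc0 : -H ≤ c0 ∧ c0 ≤ H)
    {x : ℝ} (hx : (a : ℝ) ≤ x ∧ x ≤ b) (hroot : evalL (c0 :: tail) x = 0) :
    algC0lo H a b tail ≤ c0 ∧ c0 ≤ algC0hi H a b tail := by
  obtain ⟨hLO, hM, hlo, hhi⟩ := qFrame_spec ha hx
  obtain ⟨h1, h2, hN⟩ := encloseZ_sound hLO hM hlo hhi (0 :: tail)
  have hTE : algTailEncl a b tail = encloseZ (qFrame a b).1 (qFrame a b).2.1 (qFrame a b).2.2 (0 :: tail) := rfl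
  set U := (algTailEncl a b tail).1 with hU
  set V := (algTailEncl a b tail).2.1 with hV
  set N := (algTailEncl a b tail).2.2 with hN'
  rw [← hTE] at h1 h2 hN
  have he : evalL (0 :: tail) x = -(c0 : ℝ) := by
    rw [evalL_cons] at hroot ⊢; push_cast; linarith
  rw [he] at h1 h2
  have i1 : U ≤ -c0 * N := by exact_mod_cast h1
  have i2 : -c0 * N ≤ V := by exact_mod_cast h2
  constructor
  · unfold algC0lo
    refine max_le hc0.1 ?_
    rw [neg_le, Int.le_ediv_iff_mul_le hN]; exact i2
  · unfold algC0hi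
    refine le_min hc0.2 ?_
    rw [Int.le_ediv_iff_mul_le hN]; linarith

/-- Decomposition of a description polynomial: `c = c₀ :: (mid ++ [a_d])`. [folklore] -/
theorem algDescr_decompose {d H : ℕ} (hd : 1 ≤ d) {c : List ℤ} (h : algDescrOK d H c = true) :
    ∃ (c0 : ℤ) (mid : List ℤ) (ad : ℤ), c = c0 :: (mid ++ [ad]) ∧ mid.length = d - 1 ∧
      (∀ y ∈ mid, -(H : ℤ) ≤ y ∧ y ≤ H) ∧ (1 ≤ ad ∧ ad ≤ H) ∧ (-(H : ℤ) ≤ c0 ∧ c0 ≤ H) ∧ gcdList c = 1 := by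
  simp only [algDescrOK, algPolyOK, Bool.and_eq_true, decide_eq_true_eq, List.all_eq_true, beq_iff_eq] at h
  obtain ⟨⟨⟨⟨⟨hlen, -⟩, -⟩, hH⟩, hlead⟩, hg⟩ := h
  have hb : ∀ y ∈ c, -(H : ℤ) ≤ y ∧ y ≤ H := fun y hy => abs_le.mp (hH y hy)
  obtain ⟨c0, rest, rfl⟩ : ∃ c0 rest, c = c0 :: rest := by
    cases c with
    | nil => simp at hlen
    | cons c0 rest => exact ⟨c0, rest, rfl⟩
  have hrest : rest ≠ [] := by
    intro h; subst h; simp at hlen; omega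
  obtain ⟨mid, ad, hma⟩ : ∃ mid ad, rest = mid ++ [ad] := ⟨rest.dropLast, rest.getLast hrest,
    (List.dropLast_append_getLast hrest).symm⟩
  subst hma
  have hlenm : mid.length = d - 1 := by simp at hlen; omega
  have had : (c0 :: (mid ++ [ad])).getD d 0 = ad := by
    have : d = (c0 :: mid).length := by simp; omega
    rw [this, show c0 :: (mid ++ [ad]) = (c0 :: mid) ++ [ad] by simp]
    simp
  refine ⟨c0, mid, ad, rfl, hlenm, fun y hy => hb y (by simp [hy]), ⟨?_, (hb ad (by simp)).2⟩, hb c0 (by simp), hg⟩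
  rw [had] at hlead; exact hlead

/-- **Completeness.** A description polynomial of rung `(d, H)` (`1 ≤ d`) with a root in the closed
sub-window `k` is a candidate, with its tags. [folklore] -/
theorem mem_algCandsK_of_root {d H k : ℕ} (hd : 1 ≤ d) {c : List ℤ} (h : algDescrOK d H c = true) {x : ℝ}
    (hx : x ∈ rootsIn c (segCutQ k) (segCutQ (k + 1))) :
    (algCountOf c k, true, c) ∈ algCandsK d H k := by
  obtain ⟨c0, mid, ad, rfl, hlenm, hmid, had, hc0, hg⟩ := algDescr_decompose hd h
  obtain ⟨hs1, hs2, hs0⟩ := segSupQ_spec k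
  have hxS : (((segSupQ k).1 : ℚ) : ℝ) ≤ x ∧ x ≤ (((segSupQ k).2 : ℚ) : ℝ) :=
    ⟨le_trans (by exact_mod_cast hs1) hx.1, le_trans hx.2.1 (by exact_mod_cast hs2)⟩
  refine mem_algCandsK_iff.mpr ⟨mid ++ [ad], mem_algTails_iff.mpr ⟨mid, ad, hlenm, hmid, had, rfl⟩, c0,
    alg_c0_mem_range hs0 hc0 hxS hx.2.2, ?_⟩
  rw [hg]; rfl

/-- The shape of a candidate: tags = (root count, content-one flag) of the polynomial, which is a table
polynomial of rung `(d, H)` with positive top coefficient (for `1 ≤ d`). [folklore] -/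
theorem algCandsK_shape {d H k : ℕ} (hd : 1 ≤ d) {t : Option ℕ × Bool × List ℤ} (ht : t ∈ algCandsK d H k) :
    t = (algCountOf t.2.2 k, gcdList t.2.2 == 1, t.2.2) ∧
      (gcdList t.2.2 = 1 → algDescrOK d H t.2.2 = true) := by
  obtain ⟨tail, htail, c0, hc0, rfl⟩ := mem_algCandsK_iff.mp ht
  obtain ⟨mid, ad, hlenm, hmid, had, rfl⟩ := mem_algTails_iff.mp htail
  refine ⟨rfl, fun hg => ?_⟩
  have hc0' : -(H : ℤ) ≤ c0 ∧ c0 ≤ H := ⟨le_trans (le_max_left _ _) hc0.1, le_trans hc0.2 (min_le_left _ _)⟩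
  have hlen : (c0 :: (mid ++ [ad])).length = d + 1 := by simp [hlenm]; omega
  have hgetD : (c0 :: (mid ++ [ad])).getD d 0 = ad := by
    have : d = (c0 :: mid).length := by simp [hlenm]; omega
    rw [this, show c0 :: (mid ++ [ad]) = (c0 :: mid) ++ [ad] by simp]
    simp
  have hget? : (c0 :: (mid ++ [ad]))[d]? = some ad := by
    have : d = (c0 :: mid).length := by simp [hlenm]; omega
    rw [this, show c0 :: (mid ++ [ad]) = (c0 :: mid) ++ [ad] by simp]
    simp
  have hall : ∀ y ∈ c0 :: (mid ++ [ad]), |y| ≤ (H : ℤ) := by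
    intro y hy
    rw [abs_le]
    simp only [List.mem_cons, List.mem_append] at hy
    rcases hy with rfl | hy | hy
    · exact hc0'
    · exact hmid y hy
    · rcases hy with rfl | hy
      · exact ⟨by omega, had.2⟩
      · simp at hy
  simp only [algDescrOK, algPolyOK, Bool.and_eq_true, decide_eq_true_eq, List.all_eq_true, beq_iff_eq]
  refine ⟨⟨⟨⟨⟨hlen, ?_⟩, ?_⟩, hall⟩, ?_⟩, hg⟩
  · rw [hget?]; simp; omega
  · rw [hget?]; simp
  · rw [hgetD]; exact had.1

/-! ### The meaning of a passed check -/

/-- **The meaning of a passed check.** If `algSegCheck d H k N = true` (`1 ≤ d`, `k ≤ 2`) then the set of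
DESCRIPTIONS `(c, ξ)` of rung `(d, H)` — `c` a coefficient list of degree `d`, height `≤ H`, positive top
coefficient, content `1`; `ξ` a real root of `c` — with `ξ` in the closed sub-window `[segCutQ k, segCutQ (k+1)]`
is finite and has exactly `N` elements. [folklore] -/
theorem alg_descr_ncard_of_check {d H k N : ℕ} (hd : 1 ≤ d) (hk : k ≤ 2) (h : algSegCheck d H k N = true) :
    {p : List ℤ × ℝ | algDescrOK d H p.1 = true ∧ p.2 ∈ rootsIn p.1 (segCutQ k) (segCutQ (k + 1))}.Finite ∧
    {p : List ℤ × ℝ | algDescrOK d H p.1 = true ∧ p.2 ∈ rootsIn p.1 (segCutQ k) (segCutQ (k + 1))}.ncard = N := by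
  classical
  have hab : segCutQ k ≤ segCutQ (k + 1) := by
    interval_cases k <;> norm_num [segCutQ]
  simp only [algSegCheck, Bool.and_eq_true, List.all_eq_true, beq_iff_eq] at h
  obtain ⟨⟨hall, hincr⟩, hsum⟩ := h
  set L := algCandsK d H k with hL
  set C := (L.filter fun t => t.2.1).map (fun t => t.2.2) with hC
  -- no duplicates among the candidate polynomials
  have hndL : (L.map fun t => t.2.2).Nodup := by
    have e : L.map (fun t => algCode H t.2.2) = (L.map fun t => t.2.2).map (algCode H) := by
      rw [List.map_map]; rfl
    rw [e] at hincr
    exact nodup_of_incrNat_map (algCode H) hincr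
  have hndC : C.Nodup := hndL.sublist (List.filter_sublist.map _)
  -- each PRIMITIVE candidate polynomial: finite root set with the attached count
  have hprim : ∀ t ∈ L, t.2.1 = true → gcdList t.2.2 = 1 := by
    intro t ht hp
    obtain ⟨hshape, -⟩ := algCandsK_shape hd ht
    have := congrArg (fun u : Option ℕ × Bool × List ℤ => u.2.1) hshape
    simp only at this
    rw [this] at hp; exact beq_iff_eq.mp hp
  have hcount : ∀ t ∈ L, t.2.1 = true → (rootsIn t.2.2 (segCutQ k) (segCutQ (k + 1))).Finite ∧
      (rootsIn t.2.2 (segCutQ k) (segCutQ (k + 1))).ncard = t.1.getD 0 := by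
    intro t ht hp
    obtain ⟨hshape, -⟩ := algCandsK_shape hd ht
    have hg := hprim t ht hp
    have hs := hall t ht
    obtain ⟨m, hm⟩ := Option.isSome_iff_exists.mp hs
    have hrc : algRootCount t.2.2 (segSupQ k).1 (segSupQ k).2 (segCutQ k) (segCutQ (k + 1)) = some m := by
      have := congrArg (fun u : Option ℕ × Bool × List ℤ => u.1) hshape
      simp only [algCountOf, hg, if_true] at this
      rw [← this]; exact hm
    rw [hm]
    exact algRootCount_sound (segSupQ_spec k).1 hab (segSupQ_spec k).2.1 hrc
  -- the set of descriptions = pairs over C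
  have hset : {p : List ℤ × ℝ | algDescrOK d H p.1 = true ∧ p.2 ∈ rootsIn p.1 (segCutQ k) (segCutQ (k + 1))} =
      {p : List ℤ × ℝ | p.1 ∈ C ∧ p.2 ∈ rootsIn p.1 (segCutQ k) (segCutQ (k + 1))} := by
    ext p
    simp only [Set.mem_setOf_eq, hC, List.mem_map, List.mem_filter]
    constructor
    · rintro ⟨hok, hx⟩
      have hmem := mem_algCandsK_of_root hd hok hx
      exact ⟨⟨_, ⟨hmem, rfl⟩, rfl⟩, hx⟩
    · rintro ⟨⟨t, ⟨ht, hpt⟩, hp⟩, hx⟩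
      obtain ⟨-, hok⟩ := algCandsK_shape hd ht
      have hg : gcdList t.2.2 = 1 := hprim t ht hpt
      rw [← hp]; exact ⟨hok hg, hp ▸ hx⟩
  rw [hset]
  obtain ⟨hfin, hcard⟩ := ncard_pairs_of_list (fun c => rootsIn c (segCutQ k) (segCutQ (k + 1))) C hndC
    (fun c hc => by
      obtain ⟨t, ht, rfl⟩ := List.mem_map.mp hc
      exact (hcount t (List.mem_filter.mp ht).1 (List.mem_filter.mp ht).2).1)
  refine ⟨hfin, ?_⟩
  rw [hcard, ← hsum, hC, List.map_map]
  congr 1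
  apply List.map_congr_left
  intro t ht
  exact (hcount t (List.mem_filter.mp ht).1 (List.mem_filter.mp ht).2).2

end ColumnFaceL11
end Summit.CriticalPhenomena.Ising3D
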